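import Summits.MatrixMultiplication.OmegaCensus.STPPKernelListerOrderKit

/-!
# ω-census (abelian STPP census): kernel lister — ORDER capstones MODULO an explicit dead list, over a LIST of first-block selections (kernel)

HONEST FRAMING (pub-omega census; verbatim): lottery ticket; floor = certified bounds/negative ranges.
Census STRUCTURE (seat pub-omega-stpp-2 gen 30, 2026-08-29), family (b2).  Nothing here is progress on `ω`.

Companion of `STPPKernelListerOrderKit`: the generic capstone `KLister.volume_le_of_scan` packaged for (i) a dead list `dead` whose
non-realisability in `H` is an explicit HYPOTHESIS (so the resulting order theorems are CONDITIONAL on finitely many named size patterns being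
infeasible in `H` — the residual patterns the tree laws do not decide), and (ii) a root computation split over a LIST of first-block selections
(one kernel file per selection), glued by `scanFirstC_or`: `scanFirstC_false`, `scanFirstC_any`, `volume_le_of_scan_list_dead`.
-/

open Finset

namespace Summit.MatrixMultiplication.OmegaCensus.KLister

open Literature.Computability.AlgebraicComplexity

variable {n : ℕ}

/-- The root computation with the empty selection is trivially `true`. [folklore] -/
theorem scanFirstS_false {dead : List (List Shape)} {rows : List ℕ} {kAfter : St → List Shape → Bool} :
    ∀ ss : List Shape, scanFirstS n dead (fun _ => false) rows kAfter ss = true := by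
  intro ss
  induction ss with
  | nil => rfl
  | cons s ss ih => rw [scanFirstS, ih]; rfl

/-- 〃 over the chunk list. [folklore] -/
theorem scanFirstC_false {dead : List (List Shape)} :
    ∀ L : List (List ℕ × List Shape), scanFirstC n dead (fun _ => false) L = true := by
  intro L
  induction L with
  | nil => rfl
  | cons ch rest ih =>
    obtain ⟨rows, ss⟩ := ch
    rw [scanFirstC, scanFirstS_false ss, ih]; rfl

/-- **A list of selections, each with root computation `true`, gives the root computation of their disjunction.** [folklore] -/
theorem scanFirstC_any {dead : List (List Shape)} (L : List (List ℕ × List Shape)) :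
    ∀ sels : List (Shape → Bool), (∀ sel ∈ sels, scanFirstC n dead sel L = true) →
      scanFirstC n dead (fun s => sels.any fun sel => sel s) L = true := by
  intro sels
  induction sels with
  | nil => intro _; exact scanFirstC_false L
  | cons sel rest ih =>
    intro h
    have h1 : scanFirstC n dead sel L = true := h sel List.mem_cons_self
    have h2 := ih fun t ht => h t (List.mem_cons_of_mem _ ht)
    have e : (fun s => (sel :: rest).any fun t => t s) = fun s => sel s || rest.any fun t => t s := by
      funext s; rw [List.any_cons]
    rw [e]
    exact scanFirstC_or L h1 h2

variable {H : Type*} [AddCommGroup H] [Fintype H] [DecidableEq H]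

/-- **Capstone modulo a dead list, over a list of selections:** if the packed tables of the chunked shape list `L` of order `n` are certified,
`L` lists exactly the admissible shapes, the selections `sels` jointly cover every listed shape, every selection's root computation with the
dead list `dead` returns `true`, and every pattern of `dead` is NOT realisable in the abelian group `H` of order `n`, then every STPP family of
`H` has volume `≤ n`. [cite: CohnKleinbergSzegedyUmans2005, Def. 5.1, Thm. 5.5] -/
theorem volume_le_of_scan_list_dead (hn : Fintype.card H = n) (hn0 : n ≠ 0) (L : List (List ℕ × List Shape)) (dead : List (List Shape))
    (sels : List (Shape → Bool)) (hdead : ∀ D ∈ dead, ¬ Realizable H D)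
    (hcert : chunksOK (2 * n + 2) L = true) (hadm : ((flat L).all (adm n)) = true) (hflat : flat L = shapeList n)
    (hcov : ((flat L).all fun s => sels.any fun sel => sel s) = true)
    (hscan : ∀ sel ∈ sels, scanFirstC n dead sel L = true)
    {m : ℕ} (A B C : Fin m → Finset H) (hS : IsSTPP A B C) : ∑ i, #(A i) * #(B i) * #(C i) ≤ n :=
  volume_le_of_scan hn hn0 L dead (fun s => sels.any fun sel => sel s) hdead hcert (fun s hs => List.all_eq_true.1 hadm s hs)
    (fun s hs => by rw [hflat]; exact mem_shapeList_of_adm hs) (fun s hs => List.all_eq_true.1 hcov s hs) (scanFirstC_any L sels hscan)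
    A B C hS

/-- **Capstone modulo a dead list, one full root computation** (`sels = [fun _ => true]`). [cite: CohnKleinbergSzegedyUmans2005, Def. 5.1, Thm. 5.5] -/
theorem volume_le_of_scan_dead (hn : Fintype.card H = n) (hn0 : n ≠ 0) (L : List (List ℕ × List Shape)) (dead : List (List Shape))
    (hdead : ∀ D ∈ dead, ¬ Realizable H D)
    (hcert : chunksOK (2 * n + 2) L = true) (hadm : ((flat L).all (adm n)) = true) (hflat : flat L = shapeList n)
    (hscan : scanFirstC n dead (fun _ => true) L = true)
    {m : ℕ} (A B C : Fin m → Finset H) (hS : IsSTPP A B C) : ∑ i, #(A i) * #(B i) * #(C i) ≤ n :=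
  volume_le_of_scan hn hn0 L dead (fun _ => true) hdead hcert (fun s hs => List.all_eq_true.1 hadm s hs)
    (fun s hs => by rw [hflat]; exact mem_shapeList_of_adm hs) (fun _ _ => rfl) hscan A B C hS

end Summit.MatrixMultiplication.OmegaCensus.KLister
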